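import Mathlib
import HarnessLib
import Summits.Ventures.LatticeQCDFlow.Scoring.HMCKernelTranslation
import Summits.Ventures.LatticeQCDFlow.Scoring.HMCKernelAxisPermutation

/-!
# At every HMC step from the cold or hot start, every plaquette has the same one-point law: the lattice-averaged plaquette of the run check has the expectation of any single plaquette

HONEST FRAMING: exact (Metropolis-corrected) sampling algorithms for lattice gauge theory;
figures of merit are autocorrelation/cost numbers at stated couplings and volumes; no
continuum-physics claim.

Venture `LatticeQCDFlow` (cell pub-lqcd), sub-topic `Scoring`, FANOUT row 21 (`su3-base`, arm `E2 = PBC-HMC`; acceptance (a):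
"plaquette vs literature high-precision values within 3σ" is tested on the LATTICE-AVERAGED plaquette of the chain).  NEW WORK of the
cell, a corollary sheet of row 21's `HMCKernelTranslation` (`integral_hmcChain_comp_torusConfigShift`) and `HMCKernelAxisPermutation`
(`integral_hmcChain_comp_configPerm`) for row 16's kernel `hmcKernel B β ε w` (any coupling, step, kick–drift word), with the Literature's
`plaquetteHolonomy_torusConfigShift` / `plaquetteHolonomy_configPerm`.  Def-free; nothing is cited as a fact; no number.

* `integral_hmcChain_plaquette_eq_origin` — from any start invariant under all translations and axis permutations, at every step `N`,
  for every function `f` of one plaquette holonomy, every site `x` and directions `i ≠ j`: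
  `⟨f(U_{x;ij})⟩_N = ⟨f(U_{0;i₀j₀})⟩_N` for any fixed reference pair `i₀ ≠ j₀` (translate `x` to `0`, then permute `(i, j)` to `(i₀, j₀)`);
* **`integral_hmcChain_plaquetteAverage_eq`** — hence the expectation of the AVERAGE of `f(U_p)` over any nonempty finite family of
  (site, ordered direction pair) equals the single-plaquette expectation; cold / hot start corollaries
  (`…_coldStart`, `…_hotStart`: both starts are invariant under translations and permutations).
NOT CLAIMED: anything about the variance of the average (that is where the volume helps), stationarity, arm E1, numbers.
-/

noncomputable section

open MeasureTheory ProbabilityTheory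
open Literature.MathematicalPhysics.QuantumFieldTheory
open Literature.MathematicalPhysics.QuantumFieldTheory.Luscher2010 (SuBasis)
open Summit.Ventures.LatticeQCDFlow.Exactness (nHit)

namespace Summit.Ventures.LatticeQCDFlow.Scoring

variable {d L n : ℕ} [NeZero L] (B : SuBasis n) (β ε : ℝ) (w : List MDOp)

/-- **Every plaquette has the same one-point law at every step**: from a start invariant under all translations and all axis
permutations, `⟨f(U_{x;ij})⟩_N = ⟨f(U_{0;i₀j₀})⟩_N` for every site `x` and every pair of distinct directions `(i, j)`, given a reference
pair `i₀ ≠ j₀`. -/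
theorem integral_hmcChain_plaquette_eq_origin {μ₀ : Measure (GaugeConfig d L (Matrix.specialUnitaryGroup (Fin n) ℂ))}
    (hT : ∀ v : Site d L, μ₀.map (TorusTranslation.torusConfigShift v) = μ₀)
    (hP : ∀ π : Equiv.Perm (Fin d), μ₀.map (configPerm π) = μ₀) (N : ℕ) {E : Type*} [NormedAddCommGroup E] [NormedSpace ℝ E]
    (f : Matrix.specialUnitaryGroup (Fin n) ℂ → E) {i₀ j₀ : Fin d} (h₀ : i₀ ≠ j₀) (x : Site d L) {i j : Fin d} (hij : i ≠ j) :
    ∫ U, f (plaquetteHolonomy U x i j) ∂(μ₀.bind (nHit (hmcKernel B β ε w) N)) =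
      ∫ U, f (plaquetteHolonomy U 0 i₀ j₀) ∂(μ₀.bind (nHit (hmcKernel B β ε w) N)) := by
  -- translate `x` to the origin
  have h1 := integral_hmcChain_plaquette_translate B β ε w x (hT x) N f x i j
  rw [sub_self] at h1
  rw [← h1]
  -- a permutation `π` with `π⁻¹ i₀ = i`, `π⁻¹ j₀ = j`, i.e. `π i = i₀`, `π j = j₀`
  obtain ⟨π, hπi, hπj⟩ : ∃ π : Equiv.Perm (Fin d), π i = i₀ ∧ π j = j₀ := by
    classical
    refine ⟨(Equiv.swap i i₀).trans (Equiv.swap ((Equiv.swap i i₀) j) j₀), ?_, ?_⟩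
    · simp only [Equiv.trans_apply, Equiv.swap_apply_left]
      rw [Equiv.swap_apply_of_ne_of_ne]
      · intro h
        exact hij ((Equiv.swap i i₀).injective (by rw [Equiv.swap_apply_left]; exact h))
      · intro h
        exact h₀ h
    · simp only [Equiv.trans_apply, Equiv.swap_apply_left]
  have h2 := integral_hmcChain_plaquette_configPerm B β ε w π (hP π) N f 0 i₀ j₀
  have hs : sitePerm π.symm (0 : Site d L) = 0 := rfl
  rw [hs, show π.symm i₀ = i from by rw [Equiv.symm_apply_eq]; exact hπi.symm,
    show π.symm j₀ = j from by rw [Equiv.symm_apply_eq]; exact hπj.symm] at h2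
  exact h2

/-- **THE LATTICE-AVERAGED PLAQUETTE HAS THE SINGLE-PLAQUETTE EXPECTATION AT EVERY STEP**: for every nonempty finite family `P`
of (site, direction pair with `i ≠ j`) and every integrable-or-not `f` (Bochner junk both sides when not),
`⟨|P|⁻¹ Σ_{p∈P} f(U_p)⟩_N = ⟨f(U_{0;i₀j₀})⟩_N`, provided each `f(U_p)` is integrable for the `N`-step law. -/
theorem integral_hmcChain_plaquetteAverage_eq {μ₀ : Measure (GaugeConfig d L (Matrix.specialUnitaryGroup (Fin n) ℂ))}
    (hT : ∀ v : Site d L, μ₀.map (TorusTranslation.torusConfigShift v) = μ₀)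
    (hP : ∀ π : Equiv.Perm (Fin d), μ₀.map (configPerm π) = μ₀) (N : ℕ)
    (f : Matrix.specialUnitaryGroup (Fin n) ℂ → ℝ) {i₀ j₀ : Fin d} (h₀ : i₀ ≠ j₀)
    (P : Finset (Site d L × {q : Fin d × Fin d // q.1 ≠ q.2})) (hP0 : P.Nonempty)
    (hint : ∀ p ∈ P, Integrable (fun U : GaugeConfig d L (Matrix.specialUnitaryGroup (Fin n) ℂ) =>
      f (plaquetteHolonomy U p.1 p.2.1.1 p.2.1.2)) (μ₀.bind (nHit (hmcKernel B β ε w) N))) :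
    ∫ U, (P.card : ℝ)⁻¹ * ∑ p ∈ P, f (plaquetteHolonomy U p.1 p.2.1.1 p.2.1.2) ∂(μ₀.bind (nHit (hmcKernel B β ε w) N)) =
      ∫ U, f (plaquetteHolonomy U 0 i₀ j₀) ∂(μ₀.bind (nHit (hmcKernel B β ε w) N)) := by
  rw [integral_const_mul, integral_finsetSum P hint]
  have heach : ∀ p ∈ P, ∫ U, f (plaquetteHolonomy U p.1 p.2.1.1 p.2.1.2) ∂(μ₀.bind (nHit (hmcKernel B β ε w) N)) =
      ∫ U, f (plaquetteHolonomy U 0 i₀ j₀) ∂(μ₀.bind (nHit (hmcKernel B β ε w) N)) :=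
    fun p _ => integral_hmcChain_plaquette_eq_origin B β ε w hT hP N f h₀ p.1 p.2.2
  rw [Finset.sum_congr rfl heach, Finset.sum_const, nsmul_eq_mul, ← mul_assoc,
    inv_mul_cancel₀ (Nat.cast_ne_zero.2 (Finset.card_pos.2 hP0).ne'), one_mul]

/-- **Cold start** (`U ≡ 1`): the averaged plaquette has the single-plaquette expectation at every step. -/
theorem integral_hmcColdStart_plaquetteAverage_eq (N : ℕ) (f : Matrix.specialUnitaryGroup (Fin n) ℂ → ℝ) {i₀ j₀ : Fin d}
    (h₀ : i₀ ≠ j₀) (P : Finset (Site d L × {q : Fin d × Fin d // q.1 ≠ q.2})) (hP0 : P.Nonempty)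
    (hint : ∀ p ∈ P, Integrable (fun U : GaugeConfig d L (Matrix.specialUnitaryGroup (Fin n) ℂ) =>
      f (plaquetteHolonomy U p.1 p.2.1.1 p.2.1.2))
      ((Measure.dirac (1 : GaugeConfig d L (Matrix.specialUnitaryGroup (Fin n) ℂ))).bind (nHit (hmcKernel B β ε w) N))) :
    ∫ U, (P.card : ℝ)⁻¹ * ∑ p ∈ P, f (plaquetteHolonomy U p.1 p.2.1.1 p.2.1.2)
        ∂((Measure.dirac (1 : GaugeConfig d L (Matrix.specialUnitaryGroup (Fin n) ℂ))).bind (nHit (hmcKernel B β ε w) N)) =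
      ∫ U, f (plaquetteHolonomy U 0 i₀ j₀)
        ∂((Measure.dirac (1 : GaugeConfig d L (Matrix.specialUnitaryGroup (Fin n) ℂ))).bind (nHit (hmcKernel B β ε w) N)) :=
  integral_hmcChain_plaquetteAverage_eq B β ε w dirac_one_map_torusConfigShift dirac_one_map_configPerm N f h₀ P hP0 hint

/-- **Hot start** (`∏ dHaar`): the averaged plaquette has the single-plaquette expectation at every step. -/
theorem integral_hmcHotStart_plaquetteAverage_eq (N : ℕ) (f : Matrix.specialUnitaryGroup (Fin n) ℂ → ℝ) {i₀ j₀ : Fin d}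
    (h₀ : i₀ ≠ j₀) (P : Finset (Site d L × {q : Fin d × Fin d // q.1 ≠ q.2})) (hP0 : P.Nonempty)
    (hint : ∀ p ∈ P, Integrable (fun U : GaugeConfig d L (Matrix.specialUnitaryGroup (Fin n) ℂ) =>
      f (plaquetteHolonomy U p.1 p.2.1.1 p.2.1.2))
      ((Measure.pi fun _ : Edge d L => haarProbability (Matrix.specialUnitaryGroup (Fin n) ℂ)).bind (nHit (hmcKernel B β ε w) N))) :
    ∫ U, (P.card : ℝ)⁻¹ * ∑ p ∈ P, f (plaquetteHolonomy U p.1 p.2.1.1 p.2.1.2)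
        ∂((Measure.pi fun _ : Edge d L => haarProbability (Matrix.specialUnitaryGroup (Fin n) ℂ)).bind (nHit (hmcKernel B β ε w) N)) =
      ∫ U, f (plaquetteHolonomy U 0 i₀ j₀)
        ∂((Measure.pi fun _ : Edge d L => haarProbability (Matrix.specialUnitaryGroup (Fin n) ℂ)).bind (nHit (hmcKernel B β ε w) N)) :=
  integral_hmcChain_plaquetteAverage_eq B β ε w piHaar_map_torusConfigShift piHaar_map_configPerm N f h₀ P hP0 hint

end Summit.Ventures.LatticeQCDFlow.Scoring
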